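import Mathlib
import Literature.NumberTheory.Transcendental.KZCalculusProofs
import Literature.NumberTheory.Transcendental.KZLogCalculusProofs
import Literature.NumberTheory.Transcendental.KZHomotopyMoves
import Literature.NumberTheory.Transcendental.KZProductIdeal
import Literature.NumberTheory.Transcendental.KZSemialgebraicComplex
import Literature.NumberTheory.Transcendental.KZIdealTetrahedron
import Literature.NumberTheory.Transcendental.KZIntervalPeriodProofs
import Literature.NumberTheory.Transcendental.KZDominatedFamilyRelations
import Summits.KontsevichZagierPeriods.KontsevichZagierPeriods.Theorems.HyperbolicBlochOffTetraSectorKernelStubGoldenDilog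
import Summits.KontsevichZagierPeriods.KontsevichZagierPeriods.Theorems.HyperbolicBlochOffTetraSectorKernelStubDilogShear
import Summits.KontsevichZagierPeriods.KontsevichZagierPeriods.Theorems.HyperbolicBlochOffTetraSectorKernelStubStripToLogBand
import Summits.KontsevichZagierPeriods.KontsevichZagierPeriods.Theorems.HyperbolicBlochOffTetraSectorKernelStubMoebiusCovLift
import Summits.KontsevichZagierPeriods.KontsevichZagierPeriods.Theorems.HyperbolicBlochOffTetraSectorKernelAbelFiveTermAux

/-!
# `OffTetraSectorKernel`, line `odd-hyperbolic-ladder` (v9): Abel's five-term equation — the dilogarithm side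

For real algebraic `0 < x, y < 1` the five dilogarithm carriers of Abel's equation,
`[T x] + [T y] − [T xy] − [T X] − [T Y]` (`T a = {0 < t < u < a}` with `1/(u(1−t))`,
`X = x(1−y)/(1−xy)`, `Y = y(1−x)/(1−xy)`), are move-equivalent to four UNFOLDED-LOGARITHM BANDS over
the homotopy interval `0 < t < y`:
`[CX] + [By] − [Cxy] − [CY]` with fibre bounds `P(t) = (1−xt)/(1−x)`, `1/(1−t)`, `1/(1−xt)`,
`Q(t) = (1−xt)/(1−t)` and integrands `(Q′/Q)(t)/w`, `(1/t)/w`, `(1/t)/w`, `(1/t − P′/P)(t)/w`.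
Moves: the dissection `T x = T X ⊔ strip` (rule (1a)), the shear `(u,s) ↦ (u,us)` (`stub_dilogShear`),
the flip + fibre substitution (`stub_stripToLogBand`), and the Möbius base changes `u = x t`,
`u = Y(t)`, `u = X(t)` (`stub_moebiusCovLift`).

References: M. Kontsevich, D. Zagier, *Periods* (2001), §1.2; N. H. Abel, *Note sur la fonction
`ψx = x + x²/2² + x³/3² + ⋯`* (1826), Œuvres II, 189–193.
-/

noncomputable section

open Set MeasureTheory
open Literature.NumberTheory.Transcendental Literature.ModelTheory.ExponentialFields

namespace Summit.KontsevichZagierPeriods.HyperbolicBloch.OffTetraSectorKernel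

/-! ### Scalar facts -/

/-- `0 < 1 − x y`. [folklore] -/
theorem abel_one_sub_mul_pos {x y : ℝ} (hx0 : 0 < x) (hx1 : x < 1) (hy1 : y < 1) : 0 < 1 - x * y := by
  nlinarith

/-- `0 < X = x(1−y)/(1−xy)`. [folklore] -/
theorem abel_X_pos {x y : ℝ} (hx0 : 0 < x) (hx1 : x < 1) (hy1 : y < 1) :
    0 < x * (1 - y) / (1 - x * y) :=
  div_pos (mul_pos hx0 (by linarith)) (abel_one_sub_mul_pos hx0 hx1 hy1)

/-- `X = x(1−y)/(1−xy) < x`. [folklore] -/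
theorem abel_X_lt {x y : ℝ} (hx0 : 0 < x) (hx1 : x < 1) (hy0 : 0 < y) (hy1 : y < 1) :
    x * (1 - y) / (1 - x * y) < x := by
  rw [div_lt_iff₀ (abel_one_sub_mul_pos hx0 hx1 hy1)]
  nlinarith [mul_pos hx0 hy0]

/-- `0 < Y = y(1−x)/(1−xy)`. [folklore] -/
theorem abel_Y_pos {x y : ℝ} (hx0 : 0 < x) (hx1 : x < 1) (hy0 : 0 < y) (hy1 : y < 1) :
    0 < y * (1 - x) / (1 - x * y) :=
  div_pos (mul_pos hy0 (by linarith)) (abel_one_sub_mul_pos hx0 hx1 hy1)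

/-- `Y = y(1−x)/(1−xy) < 1`. [folklore] -/
theorem abel_Y_lt_one {x y : ℝ} (hx0 : 0 < x) (hx1 : x < 1) (hy1 : y < 1) :
    y * (1 - x) / (1 - x * y) < 1 := by
  rw [div_lt_one (abel_one_sub_mul_pos hx0 hx1 hy1)]
  nlinarith

/-- The dilogarithm triangle `{0 < t < u < a}` written with an explicit `0 < u`. [folklore] -/
theorem abel_triangle_eq (a : ℝ) :
    {w : Fin 2 → ℝ | 0 < w 1 ∧ w 1 < w 0 ∧ w 0 < a} =
      {w | 0 < w 0 ∧ w 0 < a ∧ 0 < w 1 ∧ w 1 < w 0} := by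
  ext w
  simp only [mem_setOf_eq]
  constructor
  · rintro ⟨h1, h2, h3⟩
    exact ⟨h1.trans h2, h3, h1, h2⟩
  · rintro ⟨-, h2, h3, h4⟩
    exact ⟨h3, h4, h2⟩

/-! ### From a dilogarithm triangle to its band (`α = 0`) -/

/-- **`[T a] ≡ [band over (0,a)]`**: for real algebraic `0 < a < 1`, any dilogarithm triangle on `a`
and any unfolded-log band `{0<u<a, 1 ≤ w ≤ 1/(1−u)}` with `1/(uw)` differ by relations — shear to the
rectangle (`stub_dilogShear`), then flip + fibre substitution (`stub_stripToLogBand`).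
[cite: KontsevichZagier2001, §1.2 rule (2)] -/
theorem abel_triangle_sub_band {a : ℝ} (ha : IsAlgebraic ℚ a) (ha0 : 0 < a) (ha1 : a < 1)
    (L B : KZ.IntegralRep 2) (hL : L.domain = {w | 0 < w 1 ∧ w 1 < w 0 ∧ w 0 < a})
    (hLi : EqOn L.integrand (fun w => 1 / (w 0 * (1 - w 1))) L.domain)
    (hB : B.domain = {w | 0 < w 0 ∧ w 0 < a ∧ 1 ≤ w 1 ∧ w 1 ≤ 1 / (1 - w 0)})
    (hBi : EqOn B.integrand (fun w => 1 / (w 0 * w 1)) B.domain) :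
    KZ.of L - KZ.of B ∈ KZ.relations := by
  obtain ⟨R, hRd, hRi⟩ := abel_exists_dilogRect isAlgebraic_zero ha le_rfl ha1
  have h1 : KZ.of L - KZ.of R ∈ KZ.relations :=
    stub_dilogShear 0 a isAlgebraic_zero ha le_rfl ha0 ha1.le L R (hL.trans (abel_triangle_eq a)) hLi
      hRd (fun w _ => by rw [hRi])
  have h2 : KZ.of R - KZ.of B ∈ KZ.relations :=
    stub_stripToLogBand 0 a isAlgebraic_zero ha le_rfl ha0 ha1.le R B hRd (fun w _ => by rw [hRi])
      hB hBi
  have : KZ.of L - KZ.of B = (KZ.of L - KZ.of R) + (KZ.of R - KZ.of B) := by abel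
  rw [this]
  exact KZ.relations.add_mem h1 h2

/-! ### The term `Li₂(y)`: already over the homotopy interval -/

/-! ### The term `Li₂(xy)`: base change `u = x t` -/

/-- **`[T(xy)] ≡ [Cxy]`**, `Cxy = [{0<t<y, 1 ≤ w ≤ 1/(1−xt)}, 1/(tw)]`: triangle → band over `(0, xy)`,
then the linear base change `u = x t` (`stub_moebiusCovLift` with `(a,b,c,d) = (x,0,0,1)`, Jacobian `x`).
[cite: KontsevichZagier2001, §1.2 rule (2)] -/
theorem abel_term_xy {x y : ℝ} (hx : IsAlgebraic ℚ x) (hy : IsAlgebraic ℚ y) (hx0 : 0 < x) (hx1 : x < 1)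
    (hy0 : 0 < y) (hy1 : y < 1) (Lxy Cxy : KZ.IntegralRep 2)
    (hLxy : Lxy.domain = {w | 0 < w 1 ∧ w 1 < w 0 ∧ w 0 < x * y})
    (hLxyi : EqOn Lxy.integrand (fun w => 1 / (w 0 * (1 - w 1))) Lxy.domain)
    (hCxy : Cxy.domain = {z | (0 < z 0 ∧ z 0 < y) ∧ 1 ≤ z 1 ∧ z 1 ≤ 1 / (1 - x * z 0)})
    (hCxyi : EqOn Cxy.integrand (fun z => 1 / (z 0 * z 1)) Cxy.domain) :
    KZ.of Lxy - KZ.of Cxy ∈ KZ.relations := by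
  have hxy0 : 0 < x * y := mul_pos hx0 hy0
  have hxy1 : x * y < 1 := (by nlinarith : x * y < 1)
  obtain ⟨B, hBd, hBi⟩ := abel_exists_dilogBand 0 (x * y) isAlgebraic_zero (hx.mul hy) le_rfl hxy1
  have h1 : KZ.of Lxy - KZ.of B ∈ KZ.relations :=
    abel_triangle_sub_band (hx.mul hy) hxy0 hxy1 Lxy B hLxy hLxyi hBd (fun w _ => by
      rw [hBi]; simp only [div_div])
  -- the base change `u = x t`
  have h2 : KZ.of Cxy - KZ.of B ∈ KZ.relations := by
    refine stub_moebiusCovLift x 0 0 1 0 y hx isAlgebraic_zero isAlgebraic_zero isAlgebraic_one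
      isAlgebraic_zero hy hy0 (by simpa using hx0.ne') (fun t _ => by simp)
      (fun p => 1 / (1 - (x * p 0 + 0) / (0 * p 0 + 1))) (fun q => 1 / (1 - q 0))
      (fun p _ _ => rfl) Cxy B ?_ ?_ ?_
    · rw [hCxy]
      ext z
      simp only [mem_setOf_eq, add_zero, zero_mul, zero_add, div_one]
    · rw [hBd]
      ext z
      have hmin : min ((x * 0 + 0) / (0 * 0 + 1)) ((x * y + 0) / (0 * y + 1)) = 0 := by
        simp [hxy0.le]
      have hmax : max ((x * 0 + 0) / (0 * 0 + 1)) ((x * y + 0) / (0 * y + 1)) = x * y := by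
        simp [hxy0.le]
      simp only [mem_setOf_eq, hmin, hmax, and_assoc]
    · intro z hz
      have hz' := hz
      rw [hCxy] at hz'
      obtain ⟨⟨hz0, -⟩, hz1, -⟩ := hz'
      rw [hCxyi hz, hBi]
      simp only [Matrix.cons_val_zero, Matrix.cons_val_one, add_zero, zero_mul, zero_add, div_one, mul_one,
        mul_zero, sub_zero, one_pow, abs_of_pos hx0]
      have hz0' : z 0 ≠ 0 := hz0.ne'
      have hz1' : z 1 ≠ 0 := by positivity
      field_simp
  have : KZ.of Lxy - KZ.of Cxy = (KZ.of Lxy - KZ.of B) - (KZ.of Cxy - KZ.of B) := by abel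
  rw [this]
  exact KZ.relations.sub_mem h1 h2

/-! ### The term `Li₂(Y)`: base change `u = Y(t) = t(1−x)/(1−xt)` -/

/-- `1/(1 − Y(t)) = Q(t) = (1 − xt)/(1 − t)` on the homotopy interval. [folklore] -/
theorem abel_vY_eq {x t : ℝ} (hx1 : x < 1) (ht0 : 0 ≤ t) (ht1 : t < 1) :
    1 / (1 - ((1 - x) * t + 0) / (-x * t + 1)) = (1 - x * t) / (1 - t) := by
  have h1 : 1 - x * t ≠ 0 := by nlinarith
  rw [add_zero, show -x * t + 1 = 1 - x * t by ring, one_sub_div h1, one_div_div]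
  congr 1
  ring

/-- **`[T Y] ≡ [CY]`**, `CY = [{0<t<y, 1 ≤ w ≤ Q(t)}, 1/(t(1−xt)w)]`: triangle → band over `(0, Y)`,
then the Möbius base change `u = Y(t)` (`stub_moebiusCovLift` with `(a,b,c,d) = (1−x, 0, −x, 1)`,
Jacobian `(1−x)/(1−xt)²`; `(Y′/Y)(t) = 1/(t(1−xt))`). [cite: KontsevichZagier2001, §1.2 rule (2)] -/
theorem abel_term_Y :
    ∀ (x y : ℝ), IsAlgebraic ℚ x → IsAlgebraic ℚ y → 0 < x → x < 1 → 0 < y → y < 1 →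
    ∀ (LY CY : KZ.IntegralRep 2),
      LY.domain = {w | 0 < w 1 ∧ w 1 < w 0 ∧ w 0 < y * (1 - x) / (1 - x * y)} →
      Set.EqOn LY.integrand (fun w => 1 / (w 0 * (1 - w 1))) LY.domain →
      CY.domain = {z | (0 < z 0 ∧ z 0 < y) ∧ 1 ≤ z 1 ∧ z 1 ≤ (1 - x * z 0) / (1 - z 0)} →
      Set.EqOn CY.integrand (fun z => 1 / (z 0 * (1 - x * z 0) * z 1)) CY.domain →
      KZ.of LY - KZ.of CY ∈ KZ.relations := by
  intro x y hx hy hx0 hx1 hy0 hy1 LY CY hLY hLYi hCY hCYi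
  have hY0 : 0 < y * (1 - x) / (1 - x * y) := abel_Y_pos hx0 hx1 hy0 hy1
  have hY1 : y * (1 - x) / (1 - x * y) < 1 := abel_Y_lt_one hx0 hx1 hy1
  have hxy : 0 < 1 - x * y := abel_one_sub_mul_pos hx0 hx1 hy1
  have hYalg : IsAlgebraic ℚ (y * (1 - x) / (1 - x * y)) :=
    (hy.mul (isAlgebraic_one.sub hx)).mul (isAlgebraic_one.sub (hx.mul hy)).inv
  obtain ⟨B, hBd, hBi⟩ := abel_exists_dilogBand 0 _ isAlgebraic_zero hYalg le_rfl hY1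
  have h1 : KZ.of LY - KZ.of B ∈ KZ.relations :=
    abel_triangle_sub_band hYalg hY0 hY1 LY B hLY hLYi hBd (fun w _ => by
      rw [hBi]; simp only [div_div])
  have hmy : ((1 - x) * y + 0) / (-x * y + 1) = y * (1 - x) / (1 - x * y) := by
    rw [add_zero]
    congr 1 <;> ring
  have h2 : KZ.of CY - KZ.of B ∈ KZ.relations := by
    refine stub_moebiusCovLift (1 - x) 0 (-x) 1 0 y (isAlgebraic_one.sub hx) isAlgebraic_zero hx.neg
      isAlgebraic_one isAlgebraic_zero hy hy0 (by nlinarith) (fun t ht => by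
        have := ht.2; nlinarith)
      (fun p => 1 / (1 - ((1 - x) * p 0 + 0) / (-x * p 0 + 1))) (fun q => 1 / (1 - q 0))
      (fun p _ _ => rfl) CY B ?_ ?_ ?_
    · rw [hCY]
      ext z
      simp only [mem_setOf_eq]
      constructor
      · rintro ⟨⟨h0, h1⟩, h2, h3⟩
        exact ⟨⟨h0, h1⟩, h2, by rwa [abel_vY_eq hx1 h0.le (h1.trans hy1)]⟩
      · rintro ⟨⟨h0, h1⟩, h2, h3⟩
        exact ⟨⟨h0, h1⟩, h2, by rwa [abel_vY_eq hx1 h0.le (h1.trans hy1)] at h3⟩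
    · rw [hBd]
      ext z
      have hmin : min (((1 - x) * 0 + 0) / (-x * 0 + 1)) (((1 - x) * y + 0) / (-x * y + 1)) = 0 := by
        rw [hmy]; simp [hY0.le]
      have hmax : max (((1 - x) * 0 + 0) / (-x * 0 + 1)) (((1 - x) * y + 0) / (-x * y + 1)) =
          y * (1 - x) / (1 - x * y) := by
        rw [hmy]; simp [hY0.le]
      simp only [mem_setOf_eq, hmin, hmax, and_assoc]
    · intro z hz
      have hz' := hz
      rw [hCY] at hz'
      obtain ⟨⟨hz0, hzy⟩, hz1, -⟩ := hz'
      rw [hCYi hz, hBi]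
      have habs : |(1 - x) * 1 - 0 * -x| = 1 - x := by
        rw [abs_of_pos (by nlinarith)]; ring
      simp only [Matrix.cons_val_zero, Matrix.cons_val_one, habs]
      have hz0' : z 0 ≠ 0 := hz0.ne'
      have hz1' : z 1 ≠ 0 := by positivity
      have h3 : -x * z 0 + 1 ≠ 0 := by nlinarith
      have h4 : 1 - x * z 0 ≠ 0 := by nlinarith
      have h5 : (1 - x) ≠ 0 := by linarith
      field_simp
      ring
  have : KZ.of LY - KZ.of CY = (KZ.of LY - KZ.of B) - (KZ.of CY - KZ.of B) := by abel
  rw [this]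
  exact KZ.relations.sub_mem h1 h2

end Summit.KontsevichZagierPeriods.HyperbolicBloch.OffTetraSectorKernel

end
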